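import Literature.NumberTheory.Weil1965.SplitPlaceFibreMeasureInvariance
import Literature.NumberTheory.Weil1965.SplitPlaceFibreDensityScalingLimit
import Mathlib.Analysis.SpecialFunctions.Pow.Asymptotics
import HarnessLib

/-!
# Weil's step (40) at a split place: a coefficient bounded by `M ‖t‖^γ`, `γ < N − 1`, against the dilated fibre density vanishes

Topic `NumberTheory/Weil1965`; namespace `Literature.NumberTheory.Weil1965.SplitPlace`.  THEOREMS ONLY (no definition, no
instance, no notation, no named fact, no `sorry`).  Sequel of ★ `SplitPlaceFibreDensity` / ★ `SplitPlaceFibreMeasure`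
(F0P2a-p08 (g4): the fibre density `fibreDensity μ Φ b` and fibre measure `fibreMeasure μ hι b` = Weil's `|θ_b|_v` of the split
form `h(x, y) = x ⬝ᵥ y` on `K^ι × K^ι`, its continuity in `b` and the positivity at the cone `Re F_{Φ₀}(0) > 0` for the unit box
`Φ₀ = 𝟙_{𝒪^ι × 𝒪^ι}`) and ★ `SplitPlaceFibreDensityScalingLimit` (the torus scaling
`F_{Φ∘(t,t′)}(b) = ‖tt′‖ (‖tt′‖^{|ι|})⁻¹ F_Φ(tt′b)`).

THE MATHEMATICS [Weil1965, n° 50 Thm 4, end of the proof, (39)–(40), p. 74]: at a place `v` where `U(0)_v ≠ ∅` one has, for the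
difference `E'' = E′ − E` and every `i`, `|c_i(Φ′)| · F_{Φ_v}(i λ̄_t) ≤ M |t|_v^{-(N−1−…)}`-type bounds along the torus `t → ∞`;
since the dilated fibre density grows like `|t|^{N−1}` times a quantity tending to the POSITIVE cone density, a coefficient `c`
admitting a bound `|c| · |∫ Φ₀((t)⁻¹x, y) dμ_b| ≤ M |t|^γ` with `γ < N − 1` must vanish.  Here, with `N = |ι| ≥ 2`:

* `eq_zero_of_abs_mul_norm_le_of_tendsto` — the abstract squeeze: `|c| ‖G n‖ ≤ a n → 0` with `G n → G₀ ≠ 0` forces `c = 0`;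
* `tendsto_zero_of_normAbs_tendsto_zero` — `‖s n‖ → 0 ⇒ s n → 0` in `K`;
* **`eq_zero_of_fibreDensity_dilate_bound`** (CV, density form): for `s n → 0` in `K^×` and
  `|c| · ‖F_{Φ₀∘(s n, 1)}(b)‖ ≤ M · (‖s n‖⁻¹)^γ` for all `n`, `γ < |ι| − 1` ⇒ `c = 0`;
* **`eq_zero_of_integral_fibreMeasure_dilate_bound`** (CV, measure form, the pen's letter): for `‖t n‖ → ∞` and
  `|c| · |∫ 𝟙_{𝒪^ι×𝒪^ι}((t n)⁻¹ x, y) dμ_{b,v}| ≤ M · ‖t n‖^γ`, `γ < |ι| − 1` ⇒ `c = 0`.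

Cell `hodgecm-mathlib`, programme P4, ENGINE E-2 (H413), child line `F0_E2SiegelWeilWeilRange`, stub `stub_SW2_siegelWeil`,
identity road (W), row I-CLOSE-CV (pen F0P2a-p08 (g4), 2026-08-31T02:46Z): the consumer applies (CV) to `c := ĉ_B − κ c_B` of
★ `exists_measure_prod_splitLocus_eq_mul_fibreMeasure`, with the bound supplied by BOUND + I-COEFF + I-STRUCT.  HC_CM is proved
only modulo the 7 printed citations until rung 0 closes — nothing here bears on a summit statement.

## References
* [BushnellHenniart2006] C. J. Bushnell, G. Henniart, *The local Langlands conjecture for GL(2)* (2006), §1.1 (the balls `𝔭^m` of a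
  non-archimedean local field).
* [Weil1965] A. Weil, *Sur la formule de Siegel dans la théorie des groupes classiques*, Acta Math. 113 (1965) 1–87: n° 50
  Thm 4, (39)–(40) and the last paragraph of the proof (p. 74); n° 37 Prop. 6 (p. 54); n° 44 Thm 2 (p. 63).
-/

set_option autoImplicit false

noncomputable section

open MeasureTheory ValuativeRel Filter Topology Set
open scoped NNReal ENNReal Pointwise
open Literature.NumberTheory.GaloisRepresentations.IsNonarchimedeanLocalField
open Literature.NumberTheory.Automorphic

namespace Literature.NumberTheory.Weil1965.SplitPlace

variable {K : Type*} [Field K] [ValuativeRel K] [TopologicalSpace K] [IsNonarchimedeanLocalField K]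
variable {ι : Type*} [Fintype ι]

/-! ## §0 The abstract squeeze and the topology of `K` -/

omit [ValuativeRel K] [TopologicalSpace K] [IsNonarchimedeanLocalField K] in
/-- **The squeeze behind (40)**: if `|c| · ‖G n‖ ≤ a n` with `a n → 0` and `G n → G₀ ≠ 0`, then `c = 0`.
[cite: Weil1965, n° 50 Thm 4 (pp. 72–74)] -/
theorem eq_zero_of_abs_mul_norm_le_of_tendsto {c : ℝ} {G : ℕ → ℂ} {G₀ : ℂ} (hG : Tendsto G atTop (𝓝 G₀)) (hG₀ : G₀ ≠ 0)
    {a : ℕ → ℝ} (ha : Tendsto a atTop (𝓝 0)) (hbd : ∀ n, |c| * ‖G n‖ ≤ a n) : c = 0 := by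
  have h1 : Tendsto (fun n => |c| * ‖G n‖) atTop (𝓝 (|c| * ‖G₀‖)) := (hG.norm).const_mul _
  have h2 : |c| * ‖G₀‖ ≤ 0 := le_of_tendsto_of_tendsto' h1 ha hbd
  have h3 : 0 < ‖G₀‖ := norm_pos_iff.2 hG₀
  have h4 : |c| ≤ 0 := by
    by_contra h
    exact absurd h2 (not_le.2 (mul_pos (lt_of_not_ge h) h3))
  exact abs_eq_zero.1 (le_antisymm h4 (abs_nonneg c))

/-- **`‖s n‖ → 0` forces `s n → 0` in `K`** (the balls `𝔭^m` form a basis of `𝓝 0`). [cite: BushnellHenniart2006, §1.1] -/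
theorem tendsto_zero_of_normAbs_tendsto_zero {s : ℕ → K}
    (hs : Tendsto (fun n => (normAbs K (s n) : ℝ)) atTop (𝓝 0)) : Tendsto s atTop (𝓝 0) := by
  rw [hasBasis_nhds_zero_primePowBall.tendsto_right_iff]
  intro m _
  have hpos : (0 : ℝ) < (((residueFieldCard K : ℝ≥0)⁻¹) ^ (m : ℤ) : ℝ≥0) := by
    exact_mod_cast zpow_pos inv_residueFieldCard_pos (m : ℤ)
  filter_upwards [(tendsto_order.1 hs).2 _ hpos] with n hn
  rw [mem_primePowBall_iff]
  exact_mod_cast hn.le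

/-- **`‖t n‖ → ∞` forces `(t n)⁻¹ → 0` in `K`** (`‖t⁻¹‖ = ‖t‖⁻¹` and the balls `𝔭^m` are a basis of `𝓝 0`).
[cite: BushnellHenniart2006, §1.1] -/
theorem tendsto_inv_zero_of_normAbs_tendsto_atTop {t : ℕ → K}
    (ht : Tendsto (fun n => (normAbs K (t n) : ℝ)) atTop atTop) : Tendsto (fun n => (t n)⁻¹) atTop (𝓝 0) := by
  refine tendsto_zero_of_normAbs_tendsto_zero ?_
  have h := ht.inv_tendsto_atTop
  refine h.congr fun n => ?_
  rw [Pi.inv_apply, map_inv₀, NNReal.coe_inv]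

/-! ## §1 The unit box `Φ₀ = 𝟙_{𝒪^ι × 𝒪^ι}` and its dilates -/

section Dilate

variable [MeasurableSpace K] [BorelSpace K] (μ : Measure K) [μ.IsAddHaarMeasure]

omit [MeasurableSpace K] [BorelSpace K] in
/-- the dilate `z ↦ Φ₀(s • z.1, z.2)` of the unit box is `Φ₀ ∘ (e₁ × id)` for the scalar automorphism `e₁ = s • 1`; in particular
it is Schwartz–Bruhat. [cite: Weil1965, n° 50 Thm 4 (pp. 72–74)] -/
theorem indicator_box_dilate_mem_schwartzBruhat {s : K} (hs : s ≠ 0) :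
    (fun z : (ι → K) × (ι → K) =>
      (piPrimePowBall K ι 0 ×ˢ piPrimePowBall K ι 0).indicator (fun _ => (1 : ℂ)) (s • z.1, z.2)) ∈
      SchwartzBruhat ((ι → K) × (ι → K)) :=
  schwartzBruhat_comp_prodMap_linearEquiv (LinearEquiv.smulOfUnit (Units.mk0 s hs)) (LinearEquiv.refl K (ι → K))
    (indicator_box_prod_box_mem_schwartzBruhat (K := K) (ι := ι) 0)

/-- **the dilated unit box has fibre density `‖s‖ (‖s‖^{|ι|})⁻¹ F_{Φ₀}(s b)`** (★ `fibreDensity_comp_smul` at `(t, t′) = (s, 1)`).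
[cite: Weil1965, n° 50 Thm 4 (pp. 72–74)] -/
theorem fibreDensity_box_dilate [Nonempty ι] [DecidableEq ι] [MeasurableSingletonClass K] (hι : 2 ≤ Fintype.card ι)
    {s : K} {k : ℤ} (hk : normAbs K s = ((residueFieldCard K : ℝ≥0)⁻¹) ^ k) (b : K) :
    fibreDensity μ (fun z : (ι → K) × (ι → K) =>
        (piPrimePowBall K ι 0 ×ˢ piPrimePowBall K ι 0).indicator (fun _ => (1 : ℂ)) (s • z.1, z.2)) b =
      ((normAbs K s : ℝ) : ℂ) * (((normAbs K s : ℝ) : ℂ) ^ Fintype.card ι)⁻¹ *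
        fibreDensity μ ((piPrimePowBall K ι 0 ×ˢ piPrimePowBall K ι 0).indicator (fun _ => (1 : ℂ))) (s * b) := by
  have hk' : normAbs K (s * 1) = ((residueFieldCard K : ℝ≥0)⁻¹) ^ k := by rw [mul_one, hk]
  have h := fibreDensity_comp_smul μ hι (indicator_box_prod_box_mem_schwartzBruhat (K := K) (ι := ι) 0) hk' b
  simp only [one_smul, mul_one] at h
  exact h

/-! ## §2 (CV) — the coefficient vanishes: density form -/

/-- **WEIL'S STEP (40) AT A SPLIT PLACE, density form.**  Let `|ι| ≥ 2`, `γ < |ι| − 1`, `b ∈ K`, and `s n → 0` in `K^×`.  If a real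
number `c` satisfies `|c| · ‖F_{Φ₀∘(s n, 1)}(b)‖ ≤ M · (‖s n‖⁻¹)^γ` for all `n` (`Φ₀ = 𝟙_{𝒪^ι×𝒪^ι}`), then `c = 0`: indeed
`F_{Φ₀∘(s n,1)}(b) = ‖s n‖^{1−|ι|} F_{Φ₀}(s n · b)` with `F_{Φ₀}(s n · b) → F_{Φ₀}(0) ≠ 0` (continuity of the fibre density,
positivity of the cone density), so `|c| · ‖F_{Φ₀}(s n b)‖ ≤ M ‖s n‖^{|ι|−1−γ} → 0`.
[cite: Weil1965, n° 50 Thm 4 (pp. 72–74)] [cite: Weil1965, n° 37 (p. 54)] -/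
theorem eq_zero_of_fibreDensity_dilate_bound [Nonempty ι] [DecidableEq ι] [MeasurableSingletonClass K]
    (hι : 2 ≤ Fintype.card ι) {c M γ : ℝ} (hγ : γ < (Fintype.card ι : ℝ) - 1) (b : K)
    {s : ℕ → K} (hs0 : ∀ n, s n ≠ 0) (hs : Tendsto s atTop (𝓝 0))
    (hbd : ∀ n, |c| * ‖fibreDensity μ (fun z : (ι → K) × (ι → K) =>
        (piPrimePowBall K ι 0 ×ˢ piPrimePowBall K ι 0).indicator (fun _ => (1 : ℂ)) (s n • z.1, z.2)) b‖ ≤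
      M * ((normAbs K (s n) : ℝ)⁻¹) ^ γ) :
    c = 0 := by
  set Φ₀ : (ι → K) × (ι → K) → ℂ := (piPrimePowBall K ι 0 ×ˢ piPrimePowBall K ι 0).indicator (fun _ => (1 : ℂ)) with hΦ₀
  have hΦ₀SB : Φ₀ ∈ SchwartzBruhat ((ι → K) × (ι → K)) := indicator_box_prod_box_mem_schwartzBruhat (K := K) (ι := ι) 0
  -- the exponents `k n` with `‖s n‖ = q^{-k n}`
  choose k hk using fun n => exists_normAbs_eq_inv_zpow (hs0 n)
  -- the norms `x n := ‖s n‖ > 0`, tending to `0`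
  set x : ℕ → ℝ := fun n => (normAbs K (s n) : ℝ) with hx
  have hxpos : ∀ n, 0 < x n := fun n =>
    NNReal.coe_pos.2 (pos_iff_ne_zero.2 ((map_ne_zero (normAbs K)).2 (hs0 n)))
  have hx0 : Tendsto x atTop (𝓝 0) := by
    have h := (LocalFieldHaar.continuous_normAbs (F := K)).continuousAt.tendsto.comp hs
    rw [map_zero] at h
    exact NNReal.tendsto_coe.2 h
  -- `G n := F_{Φ₀}(s n · b) → F_{Φ₀}(0) ≠ 0`
  set G : ℕ → ℂ := fun n => fibreDensity μ Φ₀ (s n * b) with hG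
  have hGlim : Tendsto G atTop (𝓝 (fibreDensity μ Φ₀ 0)) := by
    have hsb : Tendsto (fun n => s n * b) atTop (𝓝 0) := by simpa using hs.mul_const b
    exact ((continuous_fibreDensity μ hι hΦ₀SB).tendsto 0).comp hsb
  have hG0 : fibreDensity μ Φ₀ 0 ≠ 0 := fibreDensity_indicator_zero_ne_zero μ hι
  -- the bound rewritten: `|c| ‖G n‖ ≤ M · x^{|ι| − 1 − γ}`
  set N : ℕ := Fintype.card ι with hN
  have hN1 : (1 : ℝ) ≤ N := by exact_mod_cast le_trans (by norm_num) hι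
  have hbd' : ∀ n, |c| * ‖G n‖ ≤ M * (x n) ^ ((N : ℝ) - 1 - γ) := by
    intro n
    have h := hbd n
    rw [fibreDensity_box_dilate μ hι (hk n) b] at h
    -- `‖(x:ℂ) * ((x:ℂ)^N)⁻¹ * G‖ = x * (x^N)⁻¹ * ‖G‖`
    rw [norm_mul, norm_mul, norm_inv, norm_pow, Complex.norm_real, Real.norm_of_nonneg (hxpos n).le] at h
    -- multiply by `x^N * x⁻¹ > 0`
    have hxn : x n ≠ 0 := (hxpos n).ne'
    have hfac : 0 < (x n) ^ N * (x n)⁻¹ := mul_pos (pow_pos (hxpos n) N) (inv_pos.2 (hxpos n))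
    have h2 := mul_le_mul_of_nonneg_right h hfac.le
    have hl : |c| * (x n * ((x n) ^ N)⁻¹ * ‖G n‖) * ((x n) ^ N * (x n)⁻¹) = |c| * ‖G n‖ := by
      field_simp
    rw [hl] at h2
    refine h2.trans (le_of_eq ?_)
    -- `M * (x⁻¹)^γ * (x^N * x⁻¹) = M * x^(N - 1 - γ)`
    rw [Real.inv_rpow (hxpos n).le, ← Real.rpow_neg (hxpos n).le, ← Real.rpow_natCast (x n) N,
      ← Real.rpow_neg_one (x n), ← Real.rpow_add (hxpos n), mul_assoc, ← Real.rpow_add (hxpos n)]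
    congr 1
    ring_nf
  -- the majorant tends to `0` since `N - 1 - γ > 0` and `x n → 0`
  have hexp : 0 < (N : ℝ) - 1 - γ := by linarith
  have ha : Tendsto (fun n => M * (x n) ^ ((N : ℝ) - 1 - γ)) atTop (𝓝 0) := by
    have h1 : Tendsto (fun n => (x n) ^ ((N : ℝ) - 1 - γ)) atTop (𝓝 0) := by
      have h := hx0.rpow_const (p := (N : ℝ) - 1 - γ) (Or.inr hexp.le)
      rwa [Real.zero_rpow hexp.ne'] at h
    simpa using h1.const_mul M
  exact eq_zero_of_abs_mul_norm_le_of_tendsto hGlim hG0 ha hbd'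

/-! ## §3 (CV) — the coefficient vanishes: fibre-measure form (the pen's letter) -/

omit [MeasurableSpace K] [BorelSpace K] in
/-- the real dilated box `z ↦ 𝟙_{𝒪^ι×𝒪^ι}(s • z.1, z.2)` is locally constant. [folklore] -/
private theorem isLocallyConstant_box_dilate_real {s : K} (hs : s ≠ 0) :
    IsLocallyConstant (fun z : (ι → K) × (ι → K) =>
      (piPrimePowBall K ι 0 ×ˢ piPrimePowBall K ι 0).indicator (fun _ => (1 : ℝ)) (s • z.1, z.2)) := by
  have h := (indicator_box_dilate_mem_schwartzBruhat (K := K) (ι := ι) hs).1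
  have heq : (fun z : (ι → K) × (ι → K) =>
      (piPrimePowBall K ι 0 ×ˢ piPrimePowBall K ι 0).indicator (fun _ => (1 : ℝ)) (s • z.1, z.2)) =
      Complex.re ∘ (fun z : (ι → K) × (ι → K) =>
        (piPrimePowBall K ι 0 ×ˢ piPrimePowBall K ι 0).indicator (fun _ => (1 : ℂ)) (s • z.1, z.2)) := by
    funext z
    by_cases hz : (s • z.1, z.2) ∈ piPrimePowBall K ι 0 ×ˢ piPrimePowBall K ι 0
    · simp only [Function.comp_apply, Set.indicator_of_mem hz, Complex.one_re]
    · simp only [Function.comp_apply, Set.indicator_of_notMem hz, Complex.zero_re]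
  rw [heq]
  exact h.comp _

omit [Fintype ι] [MeasurableSpace K] [BorelSpace K] in
/-- the real dilated box is supported in a product of boxes: if `‖s‖ = q^{-k}` then
`𝟙_{𝒪^ι×𝒪^ι}(s • x, y) ≠ 0 ⇒ (x, y) ∈ (𝔭^{-k})^ι × 𝒪^ι ⊆ (𝔭^{n₀})^ι × (𝔭^{n₀})^ι`, `n₀ = min (-k) 0`. [folklore] -/
private theorem box_dilate_real_support {s : K} {k : ℤ} (hk : normAbs K s = ((residueFieldCard K : ℝ≥0)⁻¹) ^ k) :
    ∀ z : (ι → K) × (ι → K), z ∉ piPrimePowBall K ι (min (-k) 0) ×ˢ piPrimePowBall K ι (min (-k) 0) →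
      (piPrimePowBall K ι 0 ×ˢ piPrimePowBall K ι 0).indicator (fun _ => (1 : ℝ)) (s • z.1, z.2) = 0 := by
  have hs0 : s ≠ 0 := by
    rintro rfl
    rw [map_zero] at hk
    exact (zpow_pos inv_residueFieldCard_pos k).ne hk
  intro z hz
  rw [Set.indicator_apply_eq_zero]
  intro hmem
  exfalso
  apply hz
  rw [Set.mem_prod] at hmem ⊢
  refine ⟨piPrimePowBall_antitone (min_le_left _ _) ?_, piPrimePowBall_antitone (min_le_right _ _) hmem.2⟩
  -- `s • x ∈ 𝒪^ι ⇒ x ∈ (𝔭^{-k})^ι`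
  rw [mem_piPrimePowBall_iff] at hmem ⊢
  intro i
  have hi : s * z.1 i ∈ primePowBall K 0 := by simpa [Pi.smul_apply, smul_eq_mul] using hmem.1 i
  have hinv : normAbs K s⁻¹ = ((residueFieldCard K : ℝ≥0)⁻¹) ^ (-k) := by rw [map_inv₀, hk, zpow_neg]
  have h2 : s⁻¹ * (s * z.1 i) ∈ s⁻¹ • primePowBall K 0 := Set.smul_mem_smul_set hi
  rw [LocalFieldHaar.smul_primePowBall hinv, inv_mul_cancel_left₀ hs0, zero_add] at h2
  exact h2

/-- **WEIL'S STEP (40) AT A SPLIT PLACE** (fibre-measure form) [Weil1965 n° 50, (39)–(40), p. 74].  Let `|ι| ≥ 2`,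
`γ < |ι| − 1`, `b ∈ K`, `t n ∈ K` with `‖t n‖ → ∞`, and `c, M ∈ ℝ` with
`|c| · |∫ 𝟙_{𝒪^ι×𝒪^ι}((t n)⁻¹ • x, y) dμ_{b,v}(x, y)| ≤ M · ‖t n‖^γ` for all `n`, where `μ_{b,v} = fibreMeasure μ hι b` is Weil's local fibre
measure of the split form.  Then `c = 0` — because the dilated mass is `‖t n‖^{|ι|−1} F_{Φ₀}(b / t n)` (★ `integral_fibreMeasure_eq_fibreDensity`,
★ `fibreDensity_comp_smul`) and `F_{Φ₀}(b / t n) → F_{Φ₀}(0) > 0` (continuity; the cone `U(0)_v` has positive density).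
[cite: Weil1965, n° 50 Thm 4 (pp. 72–74)] [cite: Weil1965, n° 44 Thm 2 (p. 63)] -/
theorem eq_zero_of_integral_fibreMeasure_dilate_bound [Nonempty ι] [DecidableEq ι] [MeasurableSingletonClass K]
    (hι : 2 ≤ Fintype.card ι) {c M γ : ℝ} (hγ : γ < (Fintype.card ι : ℝ) - 1) (b : K)
    {t : ℕ → K} (ht0 : ∀ n, t n ≠ 0) (ht : Tendsto (fun n => (normAbs K (t n) : ℝ)) atTop atTop)
    (hbd : ∀ n, |c| * |∫ z, (piPrimePowBall K ι 0 ×ˢ piPrimePowBall K ι 0).indicator (fun _ => (1 : ℝ))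
        ((t n)⁻¹ • z.1, z.2) ∂(fibreMeasure μ hι b)| ≤ M * (normAbs K (t n) : ℝ) ^ γ) :
    c = 0 := by
  refine eq_zero_of_fibreDensity_dilate_bound μ hι (c := c) (M := M) hγ b (s := fun n => (t n)⁻¹)
    (fun n => inv_ne_zero (ht0 n)) (tendsto_inv_zero_of_normAbs_tendsto_atTop ht) fun n => ?_
  -- identify the density of the dilated box with its fibre-measure integral
  obtain ⟨k, hk⟩ := exists_normAbs_eq_inv_zpow (inv_ne_zero (ht0 n))
  have hid := integral_fibreMeasure_eq_fibreDensity μ hι b (isLocallyConstant_box_dilate_real (inv_ne_zero (ht0 n)))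
    (box_dilate_real_support hk)
  have hcast : (fun z : (ι → K) × (ι → K) => (((piPrimePowBall K ι 0 ×ˢ piPrimePowBall K ι 0).indicator
      (fun _ => (1 : ℝ)) ((t n)⁻¹ • z.1, z.2) : ℝ) : ℂ)) =
      fun z => (piPrimePowBall K ι 0 ×ˢ piPrimePowBall K ι 0).indicator (fun _ => (1 : ℂ)) ((t n)⁻¹ • z.1, z.2) := by
    funext z
    by_cases hz : ((t n)⁻¹ • z.1, z.2) ∈ piPrimePowBall K ι 0 ×ˢ piPrimePowBall K ι 0
    · simp only [Set.indicator_of_mem hz, Complex.ofReal_one]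
    · simp only [Set.indicator_of_notMem hz, Complex.ofReal_zero]
  rw [hcast] at hid
  rw [← hid, Complex.norm_real, Real.norm_eq_abs, map_inv₀, NNReal.coe_inv, inv_inv]
  exact hbd n

end Dilate

end Literature.NumberTheory.Weil1965.SplitPlace

end
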